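import Summits.QuantumFields.YangMills.Theorems.PoincareLipschitzFlatRieszLogSup
import Summits.QuantumFields.YangMills.Theorems.PoincareLipschitzCovariantAntideriv
import Literature.MathematicalPhysics.QuantumFieldTheory.Balaban1983to89.B4Lemma22ZeroLatticeLpLq
import Literature.MathematicalPhysics.QuantumFieldTheory.Balaban1983to89.B4Thm110ZeroLattice
import Literature.MathematicalPhysics.QuantumFieldTheory.Balaban1983to89.B4Eq19LatticeCaccioppoli
import HarnessLib

/-!
# The block-mass shadow of the Coulomb chart, flat and SHARP: `‖∂^η G_k(0) ∂^{η*}‖_{∞→∞} ≲ log n`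

M-COUL «BLOCK-MASS step 2» (LEAD ★w1-19936 g8, card v1.34). Step 1 (`PoincareLipschitzFlatBlockMassRiesz`) bounded the gradient
of `h := G_k(0)∂^{η*}f` (`G_k(0) = (−Δ^η + m² + a_kQ_k^*Q_k)⁻¹` on `ηℤ^{d+1}`, `n = L^k` fine points per block side) by `C·n·‖f‖_∞`.
Here the factor `n` becomes the true order `log n = k·log L`: `|n(h(x+e_μ) − h(x))| ≤ C·(log₂(n+1) + 1)·F`, `C = C(d, L, window)`,
for every real bond function `f`, `|f| ≤ F`, supported in a finite set of ANY size (no volume, no `log N`).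
ROUTE (bricks by name): (1) `sup|h| ≤ (d+1)c₂F`, `n`-free — Lemma 2.2 (2.17), third operator, on `ℓ^∞`
(`B4Lemma22ZeroLatticeLpLq.GkLat_three_sup_le`) after the reindexing `x′ ↦ x′ − e_ν`; (2) the REAL equation
`n²·(−Δ)h + m²h + a_k·Bh = n·∂*f` (`B` = block mean) from `B4Thm110ZeroLattice.GkLat_apply_finsupp` by `ofReal`-injectivity — the
sites `Fin (d+1) → ℤ` ARE `B4Eq19LatticeOperators.Zd (d+1)`, so `lop ∕ dvg ∕ fdiff ∕ box ∕ gradSq` apply verbatim; (3) the bounded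
non-divergence part `b = −(m²h + a_kBh)∕n²`, `|b| ≤ (|m²₊|+|a₊|)(d+1)c₂F∕n²` (`B1.aSeq_le`), put in divergence form on `Q_{2n+2}(x)` by
the flat case (`V = ℝ`, `τ = refl`) of `PoincareLipschitzCovariantAntideriv.exists_cov_antideriv` (density `≲ F∕n`); (4) local energy
by `B4Eq19LatticeCaccioppoli.caccioppoli` (`κ = 0`, `ρ = s = n`): `gradSq h (Q_n(x)) ≲ F²n^{d−1}`; (5)
`PoincareLipschitzFlatRieszLogSup.exists_abs_fdiff_le_log_of_dvg` on `Q_n(x)`: `|fdiff μ h x| ≲ (log₂(n+1)+1)F∕n`, times `n`.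
HONEST. Flat (`A = 0`), scalar, real data: the abelian model of the multiscale Coulomb chart's `ℓ^∞` bound with its TRUE logarithm
`k·log L` (Calderón–Zygmund below the block scale) — what the tower's per-level geometric decay must beat. Nothing covariant,
nothing of the Yang–Mills tower, `HistoryTailL`, `BlockLipschitzL` or any stub is proved here; YM₃ on T³ is rung R3, not Clay.
[cite: Balaban1983RegularityDecay, Theorem (1.10) p.573, Lemma 2.2 (2.17) p.578, (2.44) p.584; Giaquinta1984, Ch. III §3 Thm 3.1 p.84]
-/

open scoped BigOperators
open Finset
namespace Summit.QuantumFields.YangMills.Theorems.PoincareLipschitzFlatBlockMassRieszLog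

open Literature.MathematicalPhysics.QuantumFieldTheory.Balaban1983to89
open B4Eq19LatticeOperators B4Eq19LatticeBoxMeans
open B3GkZeroLattice (GkLat)
open B4Green244 (opD negLap blockAvg finePt coarse)
open B4Lemma22ZeroLatticeLpLq (GkLat_three_sup_le)
open B4Thm110ZeroLattice (GkLat_apply_finsupp)
open B4Eq19LatticeCaccioppoli (caccioppoli)
open B4Eq19LatticeGradientCampanato (sum_sq_fdiff_le_gradSq dvg_add')
open Summit.QuantumFields.YangMills.Theorems.PoincareLipschitzFlatRieszLogSup (exists_abs_fdiff_le_log_of_dvg)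
open Summit.QuantumFields.YangMills.Theorems.PoincareLipschitzCovariantAntideriv (exists_cov_antideriv)

variable {d : ℕ}

/-! ## §1 Letters: the adjoint difference is `n·∂*`, the reindexing, the `n`-free sup bound of `h` -/

/-- `Σ_ν n(f(z−e_ν,ν) − f(z,ν)) = n·(∂*f)(z)` in the letters of `B4Eq19LatticeOperators` (`dvg`, `unitVec μ = Pi.single μ 1`). [folklore] -/
theorem adjDiv_eq_mul_dvg (n : ℕ) (f : Zd (d + 1) → Fin (d + 1) → ℝ) (z : Zd (d + 1)) :
    ∑ ν, (n : ℝ) * (f (z - Pi.single ν 1) ν - f z ν) = (n : ℝ) * dvg f z := by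
  rw [dvg, Finset.mul_sum]; rfl

/-- the adjoint difference of a real bond function vanishing off `S` vanishes off any `S' ⊇ S` with `S + e_ν ⊆ S'`. [folklore] -/
theorem adjDiv_eq_zero_of_support_real (n : ℝ) {f : Zd (d + 1) → Fin (d + 1) → ℝ} {S S' : Finset (Zd (d + 1))}
    (hfS : ∀ z ∉ S, ∀ ν, f z ν = 0) (hSS' : S ⊆ S') (hshift : ∀ z ∈ S, ∀ ν, z + Pi.single ν 1 ∈ S')
    {z : Zd (d + 1)} (hz : z ∉ S') :
    ∑ ν, n * (f (z - Pi.single ν 1) ν - f z ν) = 0 := by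
  refine Finset.sum_eq_zero fun ν _ => ?_
  have h1 : f z ν = 0 := hfS z (fun hzS => hz (hSS' hzS)) ν
  have h2 : f (z - Pi.single ν 1) ν = 0 := hfS _ (fun hzS => hz (by simpa using hshift _ hzS ν)) ν
  rw [h1, h2, sub_zero, mul_zero]

/-- THE REINDEXING: for `f` vanishing off `S`, `S ⊆ S'` and `S + e_ν ⊆ S'`,
`Σ_{x′∈S'} G(x′)·n(f(x′−e_ν,ν) − f(x′,ν)) = Σ_{w∈S} n(G(w+e_ν) − G(w))·f(w,ν)`. [folklore] -/
theorem sum_mul_adjDiff_eq (n : ℝ) (G : Zd (d + 1) → ℝ) {f : Zd (d + 1) → Fin (d + 1) → ℝ} {S S' : Finset (Zd (d + 1))}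
    (hfS : ∀ z ∉ S, ∀ ν, f z ν = 0) (hSS' : S ⊆ S') (hshift : ∀ z ∈ S, ∀ ν, z + Pi.single ν 1 ∈ S') (ν : Fin (d + 1)) :
    ∑ x' ∈ S', G x' * (n * (f (x' - Pi.single ν 1) ν - f x' ν))
      = ∑ w ∈ S, (n * (G (w + Pi.single ν 1) - G w)) * f w ν := by
  classical
  have h1 : ∑ x' ∈ S', G x' * (n * f x' ν) = ∑ w ∈ S, G w * (n * f w ν) := by
    rw [← Finset.sum_subset hSS' (fun x' _ hx' => by rw [hfS x' hx' ν, mul_zero, mul_zero])]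
  have hinj : Set.InjOn (fun w : Zd (d + 1) => w + Pi.single ν 1) ↑S := fun a _ b _ hab => add_right_cancel hab
  have h2 : ∑ x' ∈ S', G x' * (n * f (x' - Pi.single ν 1) ν) = ∑ w ∈ S, G (w + Pi.single ν 1) * (n * f w ν) := by
    have hsub : S.image (fun w => w + Pi.single ν 1) ⊆ S' := fun x' hx' => by
      obtain ⟨w, hw, rfl⟩ := Finset.mem_image.1 hx'; exact hshift w hw ν
    rw [← Finset.sum_subset hsub (fun x' _ hx' => ?_), Finset.sum_image hinj]
    · simp only [add_sub_cancel_right]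
    · have : x' - Pi.single ν 1 ∉ S := fun hmem => hx' (Finset.mem_image.2 ⟨_, hmem, sub_add_cancel _ _⟩)
      rw [hfS _ this ν, mul_zero, mul_zero]
  have e1 : ∑ x' ∈ S', G x' * (n * (f (x' - Pi.single ν 1) ν - f x' ν))
      = ∑ x' ∈ S', G x' * (n * f (x' - Pi.single ν 1) ν) - ∑ x' ∈ S', G x' * (n * f x' ν) := by
    rw [← Finset.sum_sub_distrib]; refine Finset.sum_congr rfl fun x' _ => by ring
  have e2 : ∑ w ∈ S, (n * (G (w + Pi.single ν 1) - G w)) * f w ν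
      = ∑ w ∈ S, G (w + Pi.single ν 1) * (n * f w ν) - ∑ w ∈ S, G w * (n * f w ν) := by
    rw [← Finset.sum_sub_distrib]; refine Finset.sum_congr rfl fun w _ => by ring
  rw [e1, e2, h1, h2]

/-- ★ **THE `n`-FREE SUP BOUND OF `h = G_k(0)∂^{η*}f`** (Lemma 2.2 (2.17), third operator, on `ℓ^∞`): with the constant `c₂` of
`B4Lemma22ZeroLatticeLpLq.GkLat_three_sup_le`, for `f` real, `|f| ≤ F`, vanishing off `S`, `S ⊆ S'`, `S + e_ν ⊆ S'`:
`|Σ_{x′∈S'} G_k(0)(z,x′)·(Σ_ν n(f(x′−e_ν,ν) − f(x′,ν)))| ≤ (d+1)·c₂·F` for every `z`.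
[cite: Balaban1983RegularityDecay, Lemma 2.2 (2.17) p.578 (third operator); dictionary (□ ↦ ηℤ^{d+1}, A = 0)] -/
theorem abs_G_adjDiv_le {ℓ k : ℕ} {a m2 c₂ : ℝ}
    (hc : ∀ (μ : Fin (d + 1)) (S : Finset (Fin (d + 1) → ℤ)) (f : (Fin (d + 1) → ℤ) → ℝ) (Fsup : ℝ), 0 ≤ Fsup →
        (∀ x' ∈ S, |f x'| ≤ Fsup) → ∀ (x : Fin (d + 1) → ℤ),
        |∑ x' ∈ S, ((((ℓ + 1) ^ k : ℕ) : ℝ) * (GkLat ℓ k a m2 x (x' + Pi.single μ 1) - GkLat ℓ k a m2 x x')) * f x'|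
          ≤ c₂ * Fsup)
    {f : Zd (d + 1) → Fin (d + 1) → ℝ} {S S' : Finset (Zd (d + 1))}
    (hfS : ∀ z ∉ S, ∀ ν, f z ν = 0) (hSS' : S ⊆ S') (hshift : ∀ z ∈ S, ∀ ν, z + Pi.single ν 1 ∈ S')
    {F : ℝ} (hF : 0 ≤ F) (hf : ∀ z ν, |f z ν| ≤ F) (z : Zd (d + 1)) :
    |∑ x' ∈ S', GkLat ℓ k a m2 z x' * ∑ ν, (((ℓ + 1) ^ k : ℕ) : ℝ) * (f (x' - Pi.single ν 1) ν - f x' ν)|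
      ≤ ((d : ℝ) + 1) * c₂ * F := by
  have hswap : ∑ x' ∈ S', GkLat ℓ k a m2 z x' * ∑ ν, (((ℓ + 1) ^ k : ℕ) : ℝ) * (f (x' - Pi.single ν 1) ν - f x' ν)
      = ∑ ν, ∑ w ∈ S, ((((ℓ + 1) ^ k : ℕ) : ℝ) * (GkLat ℓ k a m2 z (w + Pi.single ν 1) - GkLat ℓ k a m2 z w)) * f w ν := by
    rw [Finset.sum_congr rfl fun x' _ => Finset.mul_sum _ _ _, Finset.sum_comm]
    exact Finset.sum_congr rfl fun ν _ => sum_mul_adjDiff_eq _ _ hfS hSS' hshift ν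
  rw [hswap]
  calc |∑ ν, ∑ w ∈ S, ((((ℓ + 1) ^ k : ℕ) : ℝ) * (GkLat ℓ k a m2 z (w + Pi.single ν 1) - GkLat ℓ k a m2 z w)) * f w ν|
      ≤ ∑ ν, |∑ w ∈ S, ((((ℓ + 1) ^ k : ℕ) : ℝ) * (GkLat ℓ k a m2 z (w + Pi.single ν 1) - GkLat ℓ k a m2 z w)) * f w ν| :=
        Finset.abs_sum_le_sum_abs _ _
    _ ≤ ∑ _ν : Fin (d + 1), c₂ * F := Finset.sum_le_sum fun ν _ => hc ν S (fun w => f w ν) F hF (fun w _ => hf w ν) z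
    _ = ((d : ℝ) + 1) * c₂ * F := by
        rw [Finset.sum_const, Finset.card_univ, Fintype.card_fin, nsmul_eq_mul]; push_cast; ring

/-! ## §2 The real equation `n²·(−Δ)h + m²h + a_k·Bh = n·∂*f` -/

/-- ★ **THE REAL EQUATION**: `k ≥ 1`, `a > 0`, `m² ≥ 0`; `g := Σ_ν n(f(·−e_ν,ν) − f(·,ν))` vanishing off the finite `S'`,
`h(z) := Σ_{x′∈S'} G_k(0)(z,x′)g(x′)`. Then for every `y`:
`n²·(lop 0 h)(y) + m²·h(y) + a_k·(n^{d+1})⁻¹·Σ_{j} h(finePt n (coarse n y) j) = g(y)` — the operator form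
`B4Thm110ZeroLattice.GkLat_apply_finsupp` (`opD = negLap + m² + a·blockAvg`) read in `ℝ` by `ofReal`-injectivity, with
`negLap = n²·lop 0` (`B4Green244.e μ = unitVec μ = Pi.single μ 1`).
[cite: Balaban1983RegularityDecay, (2.44) p.584, (1.6) p.572; dictionary (Ω = ηℤ^{d+1}, A = 0, data n·∂*f)] -/
theorem real_equation {ℓ k : ℕ} (hℓ : 1 ≤ ℓ) (hk : 1 ≤ k) {a m2 : ℝ} (ha : 0 < a) (hm : 0 ≤ m2)
    {f : Zd (d + 1) → Fin (d + 1) → ℝ} {S' : Finset (Zd (d + 1))}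
    (hg0 : ∀ z ∉ S', ∑ ν, (((ℓ + 1) ^ k : ℕ) : ℝ) * (f (z - Pi.single ν 1) ν - f z ν) = 0) (y : Zd (d + 1)) :
    (((ℓ + 1) ^ k : ℕ) : ℝ) ^ 2 *
          lop 0 (fun z => ∑ x' ∈ S', GkLat ℓ k a m2 z x' * ∑ ν, (((ℓ + 1) ^ k : ℕ) : ℝ) * (f (x' - Pi.single ν 1) ν - f x' ν)) y +
        m2 * (∑ x' ∈ S', GkLat ℓ k a m2 y x' * ∑ ν, (((ℓ + 1) ^ k : ℕ) : ℝ) * (f (x' - Pi.single ν 1) ν - f x' ν)) +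
        B1.aSeq a ((ℓ : ℝ) + 1) k * (((((ℓ + 1) ^ k : ℕ) : ℝ) ^ (d + 1))⁻¹ *
          ∑ j : Fin (d + 1) → Fin ((ℓ + 1) ^ k),
            ∑ x' ∈ S', GkLat ℓ k a m2 (finePt ((ℓ + 1) ^ k) (coarse ((ℓ + 1) ^ k) y) j) x' *
              ∑ ν, (((ℓ + 1) ^ k : ℕ) : ℝ) * (f (x' - Pi.single ν 1) ν - f x' ν))
      = ∑ ν, (((ℓ + 1) ^ k : ℕ) : ℝ) * (f (y - Pi.single ν 1) ν - f y ν) := by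
  set g : Zd (d + 1) → ℝ := fun z => ∑ ν, (((ℓ + 1) ^ k : ℕ) : ℝ) * (f (z - Pi.single ν 1) ν - f z ν) with hgdef
  set h : Zd (d + 1) → ℝ := fun z => ∑ x' ∈ S', GkLat ℓ k a m2 z x' * g x' with hhdef
  have hgC : ∀ z ∉ S', (fun w => ((g w : ℝ) : ℂ)) z = 0 := fun z hz => by
    have hgz : g z = 0 := hg0 z hz
    simp only [hgz, Complex.ofReal_zero]
  have E := (GkLat_apply_finsupp hℓ hk ha hm S' hgC).2.2 y
  have hΦ : (fun z => ∑ x' ∈ S', ((GkLat ℓ k a m2 z x' : ℝ) : ℂ) * ((g x' : ℝ) : ℂ)) = fun z => ((h z : ℝ) : ℂ) := by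
    funext z; simp only [hhdef]; push_cast; rfl
  rw [hΦ] at E
  simp only [opD, negLap, blockAvg] at E
  have key : ((((((ℓ + 1) ^ k : ℕ) : ℝ)) ^ 2 * ∑ μ, (2 * h y - h (y + B4Green244.e μ) - h (y - B4Green244.e μ)) + m2 * h y +
      B1.aSeq a ((ℓ : ℝ) + 1) k * (((((ℓ + 1) ^ k : ℕ) : ℝ) ^ (d + 1))⁻¹ *
        ∑ j : Fin (d + 1) → Fin ((ℓ + 1) ^ k), h (finePt ((ℓ + 1) ^ k) (coarse ((ℓ + 1) ^ k) y) j)) : ℝ) : ℂ)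
      = ((g y : ℝ) : ℂ) := by
    rw [← E]; push_cast; rfl
  have key' := Complex.ofReal_injective key
  have hlop : lop 0 h y = ∑ μ, (2 * h y - h (y + B4Green244.e μ) - h (y - B4Green244.e μ)) := by
    rw [lop, zero_mul, add_zero]; rfl
  rw [hlop]
  exact key'


/-! ## §3 The flat analytic core: Riesz-log with Caccioppoli energy, in `B4Eq19` letters -/

/-- ★★ **RIESZ-LOG WITH SUP-CONTROLLED ENERGY** (any dimension `d ≥ 1`, pure `ℤ^d` potential theory): there are `K₁, K₂ > 0`
(on `d`) such that for `n ≥ 1`, `−Δu = ∂*G` on `Q_{2n+2}(x)` with `|G| ≤ m` there and `|u| ≤ H` there: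
`|∂_μu(x)| ≤ (log₂(n+1)+1)·(K₁·m + K₂·H∕n)` — `exists_abs_fdiff_le_log_of_dvg` on `Q_n(x)` with the `ℓ²`-mass
`gradSq u (Q_n(x)) ≤ (14d∕n²)(4n+5)^dH² + 4(4n+3)^d·d·m²` of `B4Eq19LatticeCaccioppoli.caccioppoli` (`κ = 0`, `ρ = s = n`);
`K₁ = K(1 + √(4^{d+1}d))`, `K₂ = K√(14d·5^d) + 1`. [folklore] [cite: Giaquinta1984, Ch. III §3 Thm 3.1 p.84, §1 Thm 1.2 p.70] -/
theorem abs_fdiff_le_log_of_dvg_of_sup (hd : 1 ≤ d) : ∃ K₁ K₂ : ℝ, 0 < K₁ ∧ 0 < K₂ ∧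
    ∀ (u : Zd d → ℝ) (G : Zd d → Fin d → ℝ) (x : Zd d) (n : ℕ), 1 ≤ n → ∀ (m H : ℝ),
      (∀ y ∈ box x (2 * (n : ℤ) + 2), lop 0 u y = dvg G y) → (∀ y ∈ box x (2 * (n : ℤ) + 2), ∀ ν, |G y ν| ≤ m) →
      (∀ y ∈ box x (2 * (n : ℤ) + 2), |u y| ≤ H) →
      ∀ μ : Fin d, |fdiff μ u x| ≤ (((Nat.log 2 (n + 1) : ℕ) : ℝ) + 1) * (K₁ * m + K₂ * H / n) := by
  obtain ⟨K, hK, hRL⟩ := exists_abs_fdiff_le_log_of_dvg (d := d) hd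
  set c₁ : ℝ := 14 * (d : ℝ) * 5 ^ d with hc₁
  set c₂ : ℝ := 4 ^ (d + 1) * (d : ℝ) with hc₂
  have hc₁0 : 0 ≤ c₁ := by positivity
  have hc₂0 : 0 ≤ c₂ := by positivity
  refine ⟨K * (1 + Real.sqrt c₂), K * Real.sqrt c₁ + 1, by positivity, by positivity, ?_⟩
  intro u G x n hn m H hEq hG hH μ
  have hnR : (1 : ℝ) ≤ n := by exact_mod_cast hn
  have hnpos : (0 : ℝ) < n := by positivity
  have hm0 : 0 ≤ m := (abs_nonneg _).trans (hG x (self_mem_box x (by positivity)) ⟨0, hd⟩)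
  have hH0 : 0 ≤ H := (abs_nonneg _).trans (hH x (self_mem_box x (by positivity)))
  -- Caccioppoli on `Q_n ⊂ Q_{2n}`
  have hsub2 : box x ((n : ℤ) + (n : ℤ)) ⊆ box x (2 * (n : ℤ) + 2) := box_mono x (by linarith)
  have hCacc := caccioppoli (κ := 0) le_rfl u G x (ρ := (n : ℤ)) (s := (n : ℤ)) (by positivity) (by exact_mod_cast hn)
    (fun y hy => hEq y (hsub2 hy))
  have hcard1 : ((box x ((n : ℤ) + (n : ℤ) + 2)).card : ℝ) = (4 * (n : ℝ) + 5) ^ d := by rw [card_box x (by positivity)]; push_cast; ring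
  have hcard2 : ((box x ((n : ℤ) + (n : ℤ) + 1)).card : ℝ) = (4 * (n : ℝ) + 3) ^ d := by rw [card_box x (by positivity)]; push_cast; ring
  have hS1 : ∑ y ∈ box x ((n : ℤ) + (n : ℤ) + 2), u y ^ 2 ≤ (4 * (n : ℝ) + 5) ^ d * H ^ 2 := by
    have hsub1 : box x ((n : ℤ) + (n : ℤ) + 2) ⊆ box x (2 * (n : ℤ) + 2) := box_mono x (by linarith)
    calc ∑ y ∈ box x ((n : ℤ) + (n : ℤ) + 2), u y ^ 2 ≤ ∑ _y ∈ box x ((n : ℤ) + (n : ℤ) + 2), H ^ 2 :=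
          Finset.sum_le_sum fun y hy => by rw [← sq_abs]; exact pow_le_pow_left₀ (abs_nonneg _) (hH y (hsub1 hy)) 2
      _ = (4 * (n : ℝ) + 5) ^ d * H ^ 2 := by rw [Finset.sum_const, nsmul_eq_mul, hcard1]
  have hS2 : ∑ y ∈ box x ((n : ℤ) + (n : ℤ) + 1), ∑ ν, G y ν ^ 2 ≤ (4 * (n : ℝ) + 3) ^ d * ((d : ℝ) * m ^ 2) := by
    have hsub1 : box x ((n : ℤ) + (n : ℤ) + 1) ⊆ box x (2 * (n : ℤ) + 2) := box_mono x (by linarith)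
    calc ∑ y ∈ box x ((n : ℤ) + (n : ℤ) + 1), ∑ ν, G y ν ^ 2
        ≤ ∑ _y ∈ box x ((n : ℤ) + (n : ℤ) + 1), (d : ℝ) * m ^ 2 := Finset.sum_le_sum fun y hy => by
          calc ∑ ν, G y ν ^ 2 ≤ ∑ _ν : Fin d, m ^ 2 := Finset.sum_le_sum fun ν _ => by
                  rw [← sq_abs]; exact pow_le_pow_left₀ (abs_nonneg _) (hG y (hsub1 hy) ν) 2
            _ = (d : ℝ) * m ^ 2 := by rw [Finset.sum_const, Finset.card_univ, Fintype.card_fin, nsmul_eq_mul]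
      _ = (4 * (n : ℝ) + 3) ^ d * ((d : ℝ) * m ^ 2) := by rw [Finset.sum_const, nsmul_eq_mul, hcard2]
  set E : ℝ := gradSq u (box x (n : ℤ)) with hE
  have hcastn : ((n : ℤ) : ℝ) = (n : ℝ) := rfl
  rw [hcastn] at hCacc
  have hEle : E ≤ 14 * (d : ℝ) / (n : ℝ) ^ 2 * ((4 * (n : ℝ) + 5) ^ d * H ^ 2) + 4 * ((4 * (n : ℝ) + 3) ^ d * ((d : ℝ) * m ^ 2)) :=
    hCacc.trans (add_le_add (mul_le_mul_of_nonneg_left hS1 (by positivity)) (mul_le_mul_of_nonneg_left hS2 (by norm_num)))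
  -- `E∕(n+1)^d ≤ c₁H²∕n² + c₂m²`
  have hr1 : (4 * (n : ℝ) + 5) ^ d ≤ 5 ^ d * ((n : ℝ) + 1) ^ d := by rw [← mul_pow]; gcongr; linarith
  have hr2 : (4 * (n : ℝ) + 3) ^ d ≤ 4 ^ d * ((n : ℝ) + 1) ^ d := by rw [← mul_pow]; gcongr; linarith
  have hpos1 : (0 : ℝ) < ((n : ℝ) + 1) ^ d := by positivity
  have hED : E / ((n : ℝ) + 1) ^ d ≤ c₁ * H ^ 2 / (n : ℝ) ^ 2 + c₂ * m ^ 2 := by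
    rw [div_le_iff₀ hpos1]
    have t1 : 14 * (d : ℝ) / (n : ℝ) ^ 2 * ((4 * (n : ℝ) + 5) ^ d * H ^ 2) ≤ c₁ * H ^ 2 / (n : ℝ) ^ 2 * ((n : ℝ) + 1) ^ d := by
      have h0 : 0 ≤ 14 * (d : ℝ) / (n : ℝ) ^ 2 * H ^ 2 := by positivity
      calc 14 * (d : ℝ) / (n : ℝ) ^ 2 * ((4 * (n : ℝ) + 5) ^ d * H ^ 2) = 14 * (d : ℝ) / (n : ℝ) ^ 2 * H ^ 2 * (4 * (n : ℝ) + 5) ^ d := by ring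
        _ ≤ 14 * (d : ℝ) / (n : ℝ) ^ 2 * H ^ 2 * (5 ^ d * ((n : ℝ) + 1) ^ d) := mul_le_mul_of_nonneg_left hr1 h0
        _ = c₁ * H ^ 2 / (n : ℝ) ^ 2 * ((n : ℝ) + 1) ^ d := by rw [hc₁]; ring
    have t2 : 4 * ((4 * (n : ℝ) + 3) ^ d * ((d : ℝ) * m ^ 2)) ≤ c₂ * m ^ 2 * ((n : ℝ) + 1) ^ d := by
      have h0 : 0 ≤ 4 * ((d : ℝ) * m ^ 2) := by positivity
      calc 4 * ((4 * (n : ℝ) + 3) ^ d * ((d : ℝ) * m ^ 2)) = 4 * ((d : ℝ) * m ^ 2) * (4 * (n : ℝ) + 3) ^ d := by ring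
        _ ≤ 4 * ((d : ℝ) * m ^ 2) * (4 ^ d * ((n : ℝ) + 1) ^ d) := mul_le_mul_of_nonneg_left hr2 h0
        _ = c₂ * m ^ 2 * ((n : ℝ) + 1) ^ d := by rw [hc₂, pow_succ]; ring
    calc E ≤ _ := hEle
      _ ≤ c₁ * H ^ 2 / (n : ℝ) ^ 2 * ((n : ℝ) + 1) ^ d + c₂ * m ^ 2 * ((n : ℝ) + 1) ^ d := add_le_add t1 t2
      _ = (c₁ * H ^ 2 / (n : ℝ) ^ 2 + c₂ * m ^ 2) * ((n : ℝ) + 1) ^ d := by ring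
  -- `√(E∕(n+1)^d) ≤ √c₁·H∕n + √c₂·m`
  have hab : ∀ a b : ℝ, 0 ≤ a → 0 ≤ b → Real.sqrt (a + b) ≤ Real.sqrt a + Real.sqrt b := fun a b ha hb => by
    rw [Real.sqrt_le_iff]
    refine ⟨by positivity, ?_⟩
    have e : (Real.sqrt a + Real.sqrt b) ^ 2 = a + b + 2 * (Real.sqrt a * Real.sqrt b) := by rw [add_sq, Real.sq_sqrt ha, Real.sq_sqrt hb]; ring
    rw [e]; linarith only [mul_nonneg (Real.sqrt_nonneg a) (Real.sqrt_nonneg b)]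
  have e1 : c₁ * H ^ 2 / (n : ℝ) ^ 2 = (Real.sqrt c₁ * H / n) ^ 2 := by rw [div_pow, mul_pow, Real.sq_sqrt hc₁0]
  have e2 : c₂ * m ^ 2 = (Real.sqrt c₂ * m) ^ 2 := by rw [mul_pow, Real.sq_sqrt hc₂0]
  have hsqrt : Real.sqrt (E / ((n : ℝ) + 1) ^ d) ≤ Real.sqrt c₁ * H / n + Real.sqrt c₂ * m := by
    refine (Real.sqrt_le_sqrt hED).trans ((hab _ _ (by positivity) (by positivity)).trans (le_of_eq ?_))
    rw [e1, e2, Real.sqrt_sq (div_nonneg (mul_nonneg (Real.sqrt_nonneg _) hH0) hnpos.le),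
      Real.sqrt_sq (mul_nonneg (Real.sqrt_nonneg _) hm0)]
  -- Riesz-log on `Q_n(x)`
  have hsubR : box x ((n : ℤ) + 2) ⊆ box x (2 * (n : ℤ) + 2) := box_mono x (by linarith)
  have hmain := hRL u G x m (n : ℤ) (by positivity) (fun y hy => hEq y (hsubR hy)) (fun y hy ν => hG y (hsubR hy) ν) μ
    E (sum_sq_fdiff_le_gradSq u _ μ)
  have htoNat : ((n : ℤ) + 1).toNat = n + 1 := by omega
  rw [htoNat, hcastn] at hmain
  set ℓg : ℝ := ((Nat.log 2 (n + 1) : ℕ) : ℝ) + 1 with hℓg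
  have hlog0 : 0 ≤ ℓg := by rw [hℓg]; positivity
  clear_value ℓg E c₁ c₂
  have hstep : K * (ℓg * (m + Real.sqrt (E / ((n : ℝ) + 1) ^ d))) ≤ ℓg * (K * (1 + Real.sqrt c₂) * m + (K * Real.sqrt c₁ + 1) * H / n) := by
    have i1 : K * (ℓg * (m + Real.sqrt (E / ((n : ℝ) + 1) ^ d))) ≤ K * (ℓg * (m + (Real.sqrt c₁ * H / n + Real.sqrt c₂ * m))) :=
      mul_le_mul_of_nonneg_left (mul_le_mul_of_nonneg_left (by linarith only [hsqrt]) hlog0) hK.le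
    have i2 : 0 ≤ ℓg * (H / n) := mul_nonneg hlog0 (div_nonneg hH0 hnpos.le)
    have e : K * (ℓg * (m + (Real.sqrt c₁ * H / n + Real.sqrt c₂ * m))) + ℓg * (H / n)
        = ℓg * (K * (1 + Real.sqrt c₂) * m + (K * Real.sqrt c₁ + 1) * H / n) := by ring
    linarith only [i1, i2, e]
  exact hmain.trans hstep

/-! ## §4 The sharp bound: `|∂^η_μ h(x)| ≤ C·(log₂(n+1)+1)·F` -/

/-- the block mean is bounded by the sup. [folklore] -/
theorem abs_blockMean_le {n : ℕ} (hn : 1 ≤ n) (h : Zd (d + 1) → ℝ) {H : ℝ} (hH : ∀ z, |h z| ≤ H) (y : Zd (d + 1)) :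
    |(((n : ℝ)) ^ (d + 1))⁻¹ * ∑ j : Fin (d + 1) → Fin n, h (finePt n (coarse n y) j)| ≤ H := by
  have hnpos : (0 : ℝ) < (n : ℝ) ^ (d + 1) := by positivity
  have hcard : (Finset.univ : Finset (Fin (d + 1) → Fin n)).card = n ^ (d + 1) := by
    rw [Finset.card_univ, Fintype.card_fun, Fintype.card_fin, Fintype.card_fin]
  rw [abs_mul, abs_inv, abs_of_pos hnpos, inv_mul_le_iff₀ hnpos]
  calc |∑ j : Fin (d + 1) → Fin n, h (finePt n (coarse n y) j)| ≤ ∑ j : Fin (d + 1) → Fin n, |h (finePt n (coarse n y) j)| :=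
        Finset.abs_sum_le_sum_abs _ _
    _ ≤ ∑ _j : Fin (d + 1) → Fin n, H := Finset.sum_le_sum fun j _ => hH _
    _ = (n : ℝ) ^ (d + 1) * H := by rw [Finset.sum_const, hcard, nsmul_eq_mul]; push_cast; ring

/-- ★★★ **THE BLOCK-MASS RIESZ BOUND, SHARP FORM (`log n`, NOT `n`)**: for `d`, `L = ℓ+1 ≥ 2` and a window `a ∈ [a₋,a₊]`
(`a₋ > 0`), `m² ∈ [0,m²₊]` there is `C = C(d, L, window) > 0` such that for every `k ≥ 1` (`n = L^k`), every window point, axis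
`μ`, site `x`, and every REAL bond function `f` vanishing off a finite `S`, with `S ⊆ S'`, `S + e_ν ⊆ S'` (`S'` finite) and
`|f| ≤ F`: the solution `h(z) := Σ_{x′∈S'} G_k(0)(z,x′)·(Σ_ν n(f(x′−e_ν,ν) − f(x′,ν)))` of `(−Δ^η + m² + a_kQ_k^*Q_k)h = ∂^{η*}f`
(`real_equation`) satisfies `|n·(h(x+e_μ) − h(x))| ≤ C·(Nat.log 2 (n+1) + 1)·F` — no volume, no support size, no `log N`.
`C = K₁M₁ + K₂H₀`: `K₁, K₂` of `abs_fdiff_le_log_of_dvg_of_sup` (dimension `d+1`), `H₀ = (d+1)c₂` (`c₂` of `GkLat_three_sup_le`),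
`W = |m²₊| + |a₊|`, `M₁ = 1 + 9WH₀` (data density `≤ M₁F∕n` after the antiderivative of `−(m²h + a_kBh)∕n²` on `Q_{2n+2}`).
[cite: Balaban1983RegularityDecay, Theorem (1.10) p.573, Lemma 2.2 (2.17) p.578, (2.44) p.584; Giaquinta1984, Ch. III §3 Thm 3.1 p.84] -/
theorem blockMass_gradient_le_log (d ℓ : ℕ) (hℓ : 1 ≤ ℓ) (amin aplus m2plus : ℝ) (ha : 0 < amin) :
    ∃ C : ℝ, 0 < C ∧ ∀ (k : ℕ), 1 ≤ k → ∀ (a m2 : ℝ), amin ≤ a → a ≤ aplus → 0 ≤ m2 → m2 ≤ m2plus →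
      ∀ (μ : Fin (d + 1)) (x : Zd (d + 1)) (f : Zd (d + 1) → Fin (d + 1) → ℝ) (S S' : Finset (Zd (d + 1))) (F : ℝ),
        (∀ z ∉ S, ∀ ν, f z ν = 0) → S ⊆ S' → (∀ z ∈ S, ∀ ν, z + Pi.single ν 1 ∈ S') → (∀ z ν, |f z ν| ≤ F) →
        |(((ℓ + 1) ^ k : ℕ) : ℝ) *
            ((∑ x' ∈ S', GkLat ℓ k a m2 (x + Pi.single μ 1) x' *
                ∑ ν, (((ℓ + 1) ^ k : ℕ) : ℝ) * (f (x' - Pi.single ν 1) ν - f x' ν)) -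
              ∑ x' ∈ S', GkLat ℓ k a m2 x x' * ∑ ν, (((ℓ + 1) ^ k : ℕ) : ℝ) * (f (x' - Pi.single ν 1) ν - f x' ν))|
          ≤ C * ((Nat.log 2 ((ℓ + 1) ^ k + 1) : ℝ) + 1) * F := by
  classical
  obtain ⟨c₂, hc₂, hsup⟩ := GkLat_three_sup_le d ℓ hℓ amin aplus m2plus ha
  obtain ⟨K₁, K₂, hK₁, hK₂, hcore⟩ := abs_fdiff_le_log_of_dvg_of_sup (d := d + 1) (by omega)
  set W : ℝ := |m2plus| + |aplus| with hW
  set H₀ : ℝ := ((d : ℝ) + 1) * c₂ with hH₀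
  set M₁ : ℝ := 1 + 9 * W * H₀ with hM₁
  have hW0 : 0 ≤ W := by positivity
  have hH₀0 : 0 ≤ H₀ := by positivity
  have hM₁1 : 1 ≤ M₁ := by have : 0 ≤ 9 * W * H₀ := (by positivity); linarith only [this, hM₁.symm.le]
  refine ⟨K₁ * M₁ + K₂ * H₀, by positivity, ?_⟩
  intro k hk a m2 h1 h2 h3 h4 μ x f S S' F hfS hSS' hshift hf
  -- letters
  set n : ℕ := (ℓ + 1) ^ k with hn
  have hn1 : 1 ≤ n := Nat.one_le_pow _ _ (by omega)
  have hnR : (1 : ℝ) ≤ n := by exact_mod_cast hn1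
  have hnpos : (0 : ℝ) < n := by positivity
  set g : Zd (d + 1) → ℝ := fun z => ∑ ν, (n : ℝ) * (f (z - Pi.single ν 1) ν - f z ν) with hgdef
  set h : Zd (d + 1) → ℝ := fun z => ∑ x' ∈ S', GkLat ℓ k a m2 z x' * g x' with hhdef
  -- the goal's left side is `n·|∂_μ h(x)|`
  have hfin : (n : ℝ) * ((∑ x' ∈ S', GkLat ℓ k a m2 (x + Pi.single μ 1) x' *
      ∑ ν, (n : ℝ) * (f (x' - Pi.single ν 1) ν - f x' ν)) -
      ∑ x' ∈ S', GkLat ℓ k a m2 x x' * ∑ ν, (n : ℝ) * (f (x' - Pi.single ν 1) ν - f x' ν))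
      = (n : ℝ) * fdiff μ h x := rfl
  rw [hfin, abs_mul, Nat.abs_cast]
  have hF0 : 0 ≤ F := (abs_nonneg _).trans (hf x 0)
  have ha' : 0 < a := ha.trans_le h1
  have hL1 : (1 : ℝ) < (ℓ : ℝ) + 1 := by have hℓR : (1 : ℝ) ≤ ℓ := (by exact_mod_cast hℓ); linarith only [hℓR]
  -- the window bound for `m² + a_k`
  set A : ℝ := B1.aSeq a ((ℓ : ℝ) + 1) k with hA
  have hA0 : 0 < A := B1.aSeq_pos ha' hL1 hk
  have hAle : A ≤ |aplus| := ((B1.aSeq_le ha' hL1 k hk).trans h2).trans (le_abs_self _)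
  have hm2le : m2 ≤ |m2plus| := h4.trans (le_abs_self _)
  have hmA : m2 + A ≤ W := by rw [hW]; linarith
  -- (1) the `n`-free sup bound of `h`
  have hHs : ∀ z, |h z| ≤ H₀ * F := fun z => by
    rw [hH₀]
    exact abs_G_adjDiv_le (fun μ' T φ Fs hFs hφ w => ((hsup k hk a m2 h1 h2 h3 h4) μ' T φ Fs hFs hφ w).2.2) hfS hSS' hshift hF0 hf z
  -- (2) the real equation
  have hg0 : ∀ z ∉ S', ∑ ν, (((ℓ + 1) ^ k : ℕ) : ℝ) * (f (z - Pi.single ν 1) ν - f z ν) = 0 := fun z hz =>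
    adjDiv_eq_zero_of_support_real _ hfS hSS' hshift hz
  have hEqn : ∀ y, (n : ℝ) ^ 2 * lop 0 h y + m2 * h y +
      A * ((((n : ℝ)) ^ (d + 1))⁻¹ * ∑ j : Fin (d + 1) → Fin n, h (finePt n (coarse n y) j)) = g y :=
    fun y => real_equation hℓ hk ha' h3 hg0 y
  have hBm : ∀ y, |(((n : ℝ)) ^ (d + 1))⁻¹ * ∑ j : Fin (d + 1) → Fin n, h (finePt n (coarse n y) j)| ≤ H₀ * F :=
    fun y => abs_blockMean_le hn1 h hHs y
  -- `g = n·∂*f`, so `(−Δ)h = ∂*(f∕n) + b` with the bounded non-divergence part `b`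
  set b : Zd (d + 1) → ℝ := fun y => lop 0 h y - dvg (fun z ν => f z ν / n) y with hbdef
  set β : ℝ := W * (H₀ * F) / (n : ℝ) ^ 2 with hβ
  have hdvgn : ∀ y, dvg (fun z ν => f z ν / n) y = dvg f y / n := fun y => by simp only [dvg, Finset.sum_div, sub_div]
  have hb : ∀ y, |b y| ≤ β := by
    intro y
    have e1 : b y = -(m2 * h y + A * ((((n : ℝ)) ^ (d + 1))⁻¹ *
        ∑ j : Fin (d + 1) → Fin n, h (finePt n (coarse n y) j))) / (n : ℝ) ^ 2 := by
      have hE := hEqn y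
      have hg : g y = (n : ℝ) * dvg f y := adjDiv_eq_mul_dvg n f y
      have hn2 : (0 : ℝ) < (n : ℝ) ^ 2 := by positivity
      have hlop : lop 0 h y = (g y - m2 * h y - A * ((((n : ℝ)) ^ (d + 1))⁻¹ *
          ∑ j : Fin (d + 1) → Fin n, h (finePt n (coarse n y) j))) / (n : ℝ) ^ 2 := by
        rw [eq_div_iff hn2.ne']; linarith only [hE]
      have eb : b y = lop 0 h y - dvg (fun z ν => f z ν / n) y := rfl
      rw [eb, hdvgn y, hlop, hg]; field_simp; ring
    rw [e1, abs_div, abs_neg, abs_of_pos (by positivity : (0 : ℝ) < (n : ℝ) ^ 2), hβ]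
    refine div_le_div_of_nonneg_right ?_ (by positivity)
    have i1 : |m2 * h y| ≤ m2 * (H₀ * F) := by rw [abs_mul, abs_of_nonneg h3]; exact mul_le_mul_of_nonneg_left (hHs y) h3
    have i2 : |A * ((((n : ℝ)) ^ (d + 1))⁻¹ * ∑ j : Fin (d + 1) → Fin n, h (finePt n (coarse n y) j))| ≤ A * (H₀ * F) := by
      rw [abs_mul, abs_of_pos hA0]; exact mul_le_mul_of_nonneg_left (hBm y) hA0.le
    calc |m2 * h y + A * ((((n : ℝ)) ^ (d + 1))⁻¹ * ∑ j : Fin (d + 1) → Fin n, h (finePt n (coarse n y) j))|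
        ≤ m2 * (H₀ * F) + A * (H₀ * F) := (abs_add_le _ _).trans (add_le_add i1 i2)
      _ = (m2 + A) * (H₀ * F) := by ring
      _ ≤ W * (H₀ * F) := mul_le_mul_of_nonneg_right hmA (by positivity)
  -- (3) the flat antiderivative of `b` on `Q_{2n+2}(x)`
  obtain ⟨g₀, hg₀eq, hg₀b⟩ := exists_cov_antideriv (d := d + 1) (V := ℝ) (by omega)
    (fun _ _ => LinearIsometryEquiv.refl ℝ ℝ) b x (2 * (n : ℤ) + 2) (M := β) (fun y _ => by rw [Real.norm_eq_abs]; exact hb y)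
  set G : Zd (d + 1) → Fin (d + 1) → ℝ := fun z ν => f z ν / n + g₀ z ν with hGdef
  have hEqG : ∀ y ∈ box x (2 * (n : ℤ) + 2), lop 0 h y = dvg G y := by
    intro y hy
    have e1 : dvg G y = dvg (fun z ν => f z ν / n) y + dvg g₀ y := dvg_add' _ _ y
    have e2 : dvg g₀ y = b y := by
      have hrefl : ∀ v : ℝ, (LinearIsometryEquiv.refl ℝ ℝ).symm v = v := fun v => rfl
      have := hg₀eq y hy; simp only [hrefl] at this; rw [dvg]; exact this
    rw [e1, e2, hbdef]; ring
  set mtot : ℝ := F / n + (2 * (2 * (n : ℝ) + 2) + 1) * β with hmtot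
  have hGb : ∀ y ∈ box x (2 * (n : ℤ) + 2), ∀ ν, |G y ν| ≤ mtot := by
    intro y hy ν
    have i1 : |f y ν / n| ≤ F / n := by rw [abs_div, abs_of_pos hnpos]; exact div_le_div_of_nonneg_right (hf y ν) hnpos.le
    have i2 : |g₀ y ν| ≤ (2 * (2 * (n : ℝ) + 2) + 1) * β := by simpa [Real.norm_eq_abs] using hg₀b y hy ν
    calc |G y ν| = |f y ν / n + g₀ y ν| := by rw [hGdef]
      _ ≤ |f y ν / n| + |g₀ y ν| := abs_add_le _ _
      _ ≤ mtot := by rw [hmtot]; exact add_le_add i1 i2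
  -- (4)+(5) the analytic core, then `n·mtot ≤ M₁F`
  have hcoreAt := hcore h G x n hn1 mtot (H₀ * F) hEqG hGb (fun y _ => hHs y) μ
  clear_value W H₀ M₁ g h b β G mtot n
  clear hfin hEqn hBm hb hg₀eq hg₀b hdvgn hg0 hEqG hGb hcore hsup
  have hnm : (n : ℝ) * mtot ≤ M₁ * F := by
    have hX : 0 ≤ W * (H₀ * F) := by positivity
    have e1 : (n : ℝ) * mtot = F + (4 * (n : ℝ) + 5) * (W * (H₀ * F)) / n := by
      rw [hmtot, hβ]; field_simp; ring
    have i1 : (4 * (n : ℝ) + 5) * (W * (H₀ * F)) / n ≤ 9 * (W * (H₀ * F)) := by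
      rw [div_le_iff₀ hnpos]
      calc (4 * (n : ℝ) + 5) * (W * (H₀ * F)) ≤ (9 * (n : ℝ)) * (W * (H₀ * F)) :=
            mul_le_mul_of_nonneg_right (by linarith only [hnR]) hX
        _ = 9 * (W * (H₀ * F)) * n := by ring
    calc (n : ℝ) * mtot = F + (4 * (n : ℝ) + 5) * (W * (H₀ * F)) / n := e1
      _ ≤ F + 9 * (W * (H₀ * F)) := by linarith only [i1]
      _ = M₁ * F := by rw [hM₁]; ring
  set ℓg : ℝ := ((Nat.log 2 (n + 1) : ℕ) : ℝ) + 1 with hℓg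
  have hlog0 : 0 ≤ ℓg := by rw [hℓg]; positivity
  clear_value ℓg
  have hn0 : (n : ℝ) ≠ 0 := hnpos.ne'
  have e : (n : ℝ) * (ℓg * (K₁ * mtot + K₂ * (H₀ * F) / n)) = ℓg * (K₁ * ((n : ℝ) * mtot) + K₂ * H₀ * F * ((n : ℝ) * (n : ℝ)⁻¹)) := by
    simp only [div_eq_mul_inv]; ring
  have h1 := mul_le_mul_of_nonneg_left hcoreAt hnpos.le
  rw [e, mul_inv_cancel₀ hn0, mul_one] at h1
  have h2 : ℓg * (K₁ * ((n : ℝ) * mtot) + K₂ * H₀ * F) ≤ ℓg * (K₁ * (M₁ * F) + K₂ * H₀ * F) :=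
    mul_le_mul_of_nonneg_left (by linarith only [mul_le_mul_of_nonneg_left hnm hK₁.le]) hlog0
  exact (h1.trans h2).trans (le_of_eq (by ring))

end Summit.QuantumFields.YangMills.Theorems.PoincareLipschitzFlatBlockMassRieszLog
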